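import Summits.AtomisticToContinuum.HydrodynamicLimit.Theorems.OneFlightGossipEngineEnergyCurrentTailsLevelCensusObjects
import Summits.AtomisticToContinuum.HydrodynamicLimit.Theorems.OneFlightGossipEngineEnergyCurrentTailsLevelCensusPreMarkFlux
import HarnessLib

/-!
# Crux `EnergyCurrentTails` (stmt-AtomisticToContinuum-9235), line `level-census-comparison`:
# the collision-RATE CEILING for energetic shells and tails (stub F1) at RUNG 0 — a certificate

Helper file (`--supports stmt-AtomisticToContinuum-9235`).  Stub F1 of the registered skeleton,
`stub_rateCeiling : RateCeiling` (Prop `RateCeiling` of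
`…Theorems.OneFlightGossipEngineEnergyCurrentTailsLevelCensusObjects`), asks, under the EVOLVED
local Gibbs law `λ_N ∘ Φ_s⁻¹` and uniformly in `N`, that energetic spheres (incoming energy in a
shell `(E₁, E₂]` or above `Y`) take part in collisions at most at `C₁ ×` the Boltzmann rate per
unit time: `E #{collisions in (s,s′] with a participant of incoming energy in
(E₁,E₂]} ≤ C₁ κ_N √E₂ (s′−s) · sup_{r∈[s,s′]} shellCensus_r(E₁,E₂)` and the speed-weighted analogue
for tails, `κ_N = clock σ N = σ²(N+1)^{1/3}`.  Off equilibrium this is a one-sided molecular-chaos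
bound for the incoming two-particle contact density (the level-indicator instance of the typed
item `AprioriTailsRattlers.ContactIntensityDomination`, stmt-AtomisticToContinuum-4604); the tree
controls the evolved law only through Liouville + `df_s/dG ≤ K^{N+1}` and `H(f_s | G) = O(N)`,
which do not price collision COUNTS, and its `N`-uniform flux bounds need a flow-INVARIANT law.
This file proves the RUNG-0 instance (constant profiles `a, θ̄ > 0`, `u`: the homogeneous Gibbs law
`G_N`, invariant under every hard-sphere flow) with `C₁ = 32 (1 + m̄)`, `m̄ = ∫ ‖w‖ dN(u,θ̄)`,
threshold `1`, `N₁ = 1`, for ALL real `s ≤ s′` (registered stub `stub_rateCeilingRung0`):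

* `lintegral_flux_levelMark_le` — the Gaussian flux moment of a level mark,
  `∫ ‖v − w‖ (𝟙_B(v) + 𝟙_B(w)) dγ^{⊗2} ≤ 2 (∫_B ‖v‖ dγ + γ(B) ∫ ‖w‖ dγ)` (`‖v − w‖ ≤ ‖v‖ + ‖w‖`);
* `sq_mul_hsDiameter_sq` — the clock identity `(N+1)² ε_N² = (N+1) κ_N`;
  `lintegral_norm_gaussMeasure_eq` — `m̄ < ∞` (first moment of a Gaussian measure, Fernique);
* `stub_rateCeilingRung0` — the certificate: the guarded event count is dominated pathwise by the
  collision pair sum of the incoming level mark over the shifted window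
  (`collisionSum_ite_indicator_le_collisionPreMarkSum`), the forward window bound at rung 0
  (`localGibbsLaw_lintegral_le_of_le_collisionPreMarkSum`) turns it into
  `16 (s′−s)(N+1)² ε_N²` times the flux moment, which is `≤ 2(1 + m̄) √E₂ N(B)` on a shell below
  `E₂ ≥ 1` and `≤ 2(1 + m̄) ∫_B ‖v‖ dN` above `Y ≥ 1`, and `(N+1) N(B) = shellCensus_r`,
  `(N+1) ∫_B ‖v‖ dN = speedCensus_r` at every time `r` (`lintegral_sum_vel_localGibbsLaw_const`).

What is NOT here: anything off equilibrium (the stub itself stays open: no tool of the tree bounds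
the incoming contact density of `λ_N ∘ Φ_s⁻¹` for non-constant profiles).

References: C. Cercignani, R. Illner, M. Pulvirenti, *The Mathematical Theory of Dilute Gases*
(1994), App. 4.A; I. Gallagher, L. Saint-Raymond, B. Texier, *From Newton to Boltzmann* (2013),
Prop. 4.1.1; I. M. Gamba, V. Panferov, C. Villani, ARMA 194 (2009) (upper Maxwellian bounds).
-/

noncomputable section

open MeasureTheory Set Filter Topology Function
open scoped ENNReal InnerProductSpace BigOperators

namespace Summit.AtomisticToContinuum.HydrodynamicLimit.Theorems.EnergyCurrentTailsLevelCensus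

open Literature.MathematicalPhysics.KineticTheory Literature.Analysis.FluidPDE
open Literature.Analysis.FunctionSpaces

/-! ### Statics: Gaussian flux moments of level marks -/

/-- **Flux moment of a one-particle level mark.**  For a probability measure `γ` on `V3` and a
measurable `B ⊆ V3` (in `ℝ≥0∞`, no moment assumption):
`∫ ‖v − w‖ (𝟙_B(v) + 𝟙_B(w)) dγ(v)dγ(w) ≤ 2 (∫_B ‖v‖ dγ + γ(B) ∫ ‖w‖ dγ)` (`‖v − w‖ ≤ ‖v‖ + ‖w‖`).
[folklore] -/
theorem lintegral_flux_levelMark_le (γ : Measure V3) [IsProbabilityMeasure γ] {B : Set V3}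
    (hB : MeasurableSet B) :
    ∫⁻ p, ENNReal.ofReal ‖p.1 - p.2‖ *
        (B.indicator (fun _ => (1 : ℝ≥0∞)) p.1 + B.indicator (fun _ => (1 : ℝ≥0∞)) p.2)
        ∂(γ.prod γ) ≤
      2 * (∫⁻ v, B.indicator (fun v => ENNReal.ofReal ‖v‖) v ∂γ +
        γ B * ∫⁻ w, ENNReal.ofReal ‖w‖ ∂γ) := by
  set nB : V3 → ℝ≥0∞ := B.indicator fun v => ENNReal.ofReal ‖v‖ with hnB
  set oB : V3 → ℝ≥0∞ := B.indicator fun _ => (1 : ℝ≥0∞) with hoB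
  set nn : V3 → ℝ≥0∞ := fun v => ENNReal.ofReal ‖v‖ with hnn
  have hnBm : Measurable nB :=
    (by fun_prop : Measurable fun v : V3 => ENNReal.ofReal ‖v‖).indicator hB
  have hoBm : Measurable oB := measurable_const.indicator hB
  have hnnm : Measurable nn := by rw [hnn]; fun_prop
  -- pointwise: `‖v − w‖ (𝟙_B v + 𝟙_B w) ≤ nB v · 1 + oB v · nn w + nn v · oB w + 1 · nB w`
  have hpt : ∀ p : V3 × V3, ENNReal.ofReal ‖p.1 - p.2‖ * (oB p.1 + oB p.2) ≤
      (nB p.1 * 1 + oB p.1 * nn p.2) + (nn p.1 * oB p.2 + 1 * nB p.2) := by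
    intro p
    have htri : ENNReal.ofReal ‖p.1 - p.2‖ ≤ nn p.1 + nn p.2 := by
      rw [hnn, ← ENNReal.ofReal_add (norm_nonneg _) (norm_nonneg _)]
      exact ENNReal.ofReal_le_ofReal (norm_sub_le _ _)
    have h1 : ENNReal.ofReal ‖p.1 - p.2‖ * oB p.1 ≤ nB p.1 * 1 + oB p.1 * nn p.2 := by
      by_cases hp : p.1 ∈ B
      · simp only [hoB, hnB, indicator_of_mem hp, mul_one, one_mul]
        exact htri
      · simp only [hoB, hnB, indicator_of_notMem hp, mul_zero, zero_mul, add_zero, le_refl]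
    have h2 : ENNReal.ofReal ‖p.1 - p.2‖ * oB p.2 ≤ nn p.1 * oB p.2 + 1 * nB p.2 := by
      by_cases hp : p.2 ∈ B
      · simp only [hoB, hnB, indicator_of_mem hp, mul_one, one_mul]
        exact htri
      · simp only [hoB, hnB, indicator_of_notMem hp, mul_zero, add_zero, le_refl]
    calc ENNReal.ofReal ‖p.1 - p.2‖ * (oB p.1 + oB p.2)
        = ENNReal.ofReal ‖p.1 - p.2‖ * oB p.1 + ENNReal.ofReal ‖p.1 - p.2‖ * oB p.2 := mul_add _ _ _
      _ ≤ _ := add_le_add h1 h2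
  have hone : ∫⁻ _v : V3, (1 : ℝ≥0∞) ∂γ = 1 := by rw [lintegral_const, measure_univ, mul_one]
  have hoBi : ∫⁻ v, oB v ∂γ = γ B := lintegral_indicator_one hB
  calc ∫⁻ p, ENNReal.ofReal ‖p.1 - p.2‖ * (oB p.1 + oB p.2) ∂(γ.prod γ)
      ≤ ∫⁻ p, (nB p.1 * 1 + oB p.1 * nn p.2) + (nn p.1 * oB p.2 + 1 * nB p.2) ∂(γ.prod γ) :=
        lintegral_mono hpt
    _ = ((∫⁻ v, nB v ∂γ) * ∫⁻ _w : V3, (1 : ℝ≥0∞) ∂γ) + (∫⁻ v, oB v ∂γ) * (∫⁻ w, nn w ∂γ) +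
          ((∫⁻ v, nn v ∂γ) * (∫⁻ w, oB w ∂γ) + (∫⁻ _v : V3, (1 : ℝ≥0∞) ∂γ) * ∫⁻ w, nB w ∂γ) := by
        have hmA : Measurable fun p : V3 × V3 => nB p.1 * 1 + oB p.1 * nn p.2 :=
          ((hnBm.comp measurable_fst).mul measurable_const).add
            ((hoBm.comp measurable_fst).mul (hnnm.comp measurable_snd))
        have hmB : Measurable fun p : V3 × V3 => nB p.1 * 1 :=
          (hnBm.comp measurable_fst).mul measurable_const
        have hmC : Measurable fun p : V3 × V3 => nn p.1 * oB p.2 :=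
          (hnnm.comp measurable_fst).mul (hoBm.comp measurable_snd)
        rw [lintegral_add_left hmA, lintegral_add_left hmB, lintegral_add_left hmC,
          lintegral_prod_mul hnBm.aemeasurable measurable_const.aemeasurable,
          lintegral_prod_mul hoBm.aemeasurable hnnm.aemeasurable,
          lintegral_prod_mul hnnm.aemeasurable hoBm.aemeasurable,
          lintegral_prod_mul measurable_const.aemeasurable hnBm.aemeasurable]
    _ = 2 * (∫⁻ v, nB v ∂γ + γ B * ∫⁻ w, nn w ∂γ) := by
        rw [hone, hoBi, mul_one, one_mul, two_mul, mul_comm (∫⁻ v, nn v ∂γ) (γ B)]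
        ring

/-! ### The scaling identity and the Gaussian mean speed -/

/-- **The clock identity** `(N+1)² ε_N² = (N+1) κ_N` (`ε_N = σ (N+1)^{-1/3}`,
`κ_N = σ² (N+1)^{1/3}`). [folklore] -/
theorem sq_mul_hsDiameter_sq (σ : ℝ) (N : ℕ) :
    ((N + 1 : ℕ) : ℝ) ^ 2 * hsDiameter σ N ^ 2 = ((N : ℝ) + 1) * clock σ N := by
  rw [hsDiameter, clock]
  push_cast
  have hx0 : (0 : ℝ) < (N : ℝ) + 1 := by positivity
  set c : ℝ := ((N : ℝ) + 1) ^ ((1 : ℝ) / 3) with hc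
  have hc0 : 0 < c := Real.rpow_pos_of_pos hx0 _
  have hc3 : c ^ 3 = (N : ℝ) + 1 := by
    rw [hc, ← Real.rpow_natCast, ← Real.rpow_mul hx0.le]
    norm_num
  have hy : ((N : ℝ) + 1) ^ (-(1 / 3 : ℝ)) = c⁻¹ := by
    rw [Real.rpow_neg hx0.le, hc]
  rw [hy, ← hc3]
  field_simp

/-- The mean speed of the Gaussian `N(u, θ)` is finite: `∫⁻ ‖w‖ dN(u,θ) = ofReal (∫ ‖w‖ dN(u,θ))`
(first absolute moment of a Gaussian measure, Fernique). [folklore] -/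
theorem lintegral_norm_gaussMeasure_eq (u : V3) (θ : ℝ) :
    ∫⁻ w, ENNReal.ofReal ‖w‖ ∂(gaussMeasure u θ) =
      ENNReal.ofReal (∫ w, ‖w‖ ∂(gaussMeasure u θ)) := by
  have hi : Integrable (fun w : V3 => ‖w‖) (gaussMeasure u θ) := by
    have h := ProbabilityTheory.IsGaussian.memLp_id (gaussMeasure u θ) 1 (by simp)
    exact (memLp_one_iff_integrable.1 h).norm
  exact (ofReal_integral_eq_lintegral_ofReal hi (Eventually.of_forall fun _ => norm_nonneg _)).symm

/-! ### The certificate -/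

/-- **Registered stub `stub_rateCeilingRung0` — the collision-rate ceiling for energetic shells and
tails (stub F1 `stub_rateCeiling : RateCeiling`) at RUNG 0 (global equilibrium), uniformly in `N`
and in the window position.**  For constant profiles `a, θ̄ > 0` and constant drift `u` there is
`σ₀ > 0` (the small reduced density of the Ruelle-type pair bound `posGibbs_pairEvent_le`) such that
for `0 < σ < σ₀` and every family of hard-sphere flows `Φ` there are `C₁ > 0` — explicitly
`C₁ = 32 (1 + m̄)`, `m̄ = ∫ ‖w‖ dN(u,θ̄)` the Gaussian mean speed — and `N₁ = 1` with, for all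
`N ≥ N₁`, ALL real `s ≤ s′`, under the homogeneous Gibbs law `G_N = localGibbsLaw σ a u θ̄ N (Φ N)`:
(shells) for every `E₁` and every `E₂ ≥ 1`, the expected number of collisions in `(s, s′]` with a
participant of incoming energy in `(E₁, E₂]` is
`≤ C₁ κ_N √E₂ (s′ − s) · sup_{r ∈ [s,s′]} shellCensus r E₁ E₂`;
(tails) for every `Y ≥ 1`, the expected number of collisions with a participant of incoming energy
`> Y` is `≤ C₁ κ_N (s′ − s) · sup_{r ∈ [s,s′]} speedCensus r Y` (`κ_N = clock σ N = σ²(N+1)^{1/3}`).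
This is the body of `RateCeiling` at constant profiles with threshold `Eth = 1`, `N₁ = 1`, no
`E₂ ≤ 2E₁` restriction, no Euler/LLN frame and `C₁` independent of the horizon (at rung 0 the census
is constant in `r`, so the supremum is attained at `r = s`).  Proof: the guarded event count is
dominated pathwise by the collision pair sum of the incoming level mark `𝟙_B(vᵢ⁻) + 𝟙_B(vⱼ⁻)`
over the shifted window (`collisionSum_ite_indicator_le_collisionPreMarkSum`); the forward window
bound at rung 0 (`localGibbsLaw_lintegral_le_of_le_collisionPreMarkSum`: previous-grid-time
bookkeeping, Fatou, invariance of `G_N`, one-window statics) gives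
`≤ 16 (s′−s)(N+1)² ε_N² ∫ ‖v − w‖ (𝟙_B(v) + 𝟙_B(w)) dN^{⊗2}`; the flux moment is
`≤ 2 (∫_B ‖v‖ + N(B) m̄) ≤ 2 (1 + m̄) √E₂ N(B)` on a shell below `E₂ ≥ 1` (resp.
`≤ 2(1 + m̄) ∫_B ‖v‖` above `Y ≥ 1`); `(N+1)² ε_N² = (N+1) κ_N` (`sq_mul_hsDiameter_sq`) and
`(N+1) N(B) = shellCensus`, `(N+1) ∫_B ‖v‖ dN = speedCensus` at every time
(`lintegral_sum_vel_localGibbsLaw_const`). [folklore] -/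
theorem stub_rateCeilingRung0 : ∀ (a θb : ℝ) (u : V3), 0 < a → 0 < θb →
    ∃ σ₀ : ℝ, 0 < σ₀ ∧ ∀ σ : ℝ, 0 < σ → σ < σ₀ →
      ∀ Φ : (N : ℕ) → HardSphereFlow (Torus.geometry (Fin 3)) (hsDiameter σ N) (N + 1),
        ∃ C₁ : ℝ, 0 < C₁ ∧ ∃ N₁ : ℕ, ∀ N : ℕ, N₁ ≤ N → ∀ s s' : ℝ, s ≤ s' →
          (∀ E₁ E₂ : ℝ, 1 ≤ E₂ →
            eventCount σ (fun _ => a) (fun _ => θb) (fun _ => u) N (Φ N) s s' (shellEvent E₁ E₂) ≤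
              ENNReal.ofReal (C₁ * clock σ N * Real.sqrt E₂ * (s' - s)) *
                ⨆ r ∈ Set.Icc s s',
                  shellCensus σ (fun _ => a) (fun _ => θb) (fun _ => u) N (Φ N) r E₁ E₂) ∧
          (∀ Y : ℝ, 1 ≤ Y →
            eventCount σ (fun _ => a) (fun _ => θb) (fun _ => u) N (Φ N) s s' (tailEvent Y) ≤
              ENNReal.ofReal (C₁ * clock σ N * (s' - s)) *
                ⨆ r ∈ Set.Icc s s',
                  speedCensus σ (fun _ => a) (fun _ => θb) (fun _ => u) N (Φ N) r Y) := by
  intro a θb u ha hθ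
  obtain ⟨σ₀, hσ₀, hsmall⟩ := exists_smallDensity uniformProfile one_pos
  refine ⟨σ₀, hσ₀, fun σ hσ hσlt Φ => ?_⟩
  have hsm : SmallDensity uniformProfile σ := (hsmall σ hσ hσlt).1
  have hσ2 : σ ≤ 1 / 2 := hsm.σ_lt_half.le
  -- the Gaussian, its mean speed `m̄`, and the constant `C₁ = 32 (1 + m̄)`
  set γ : Measure V3 := gaussMeasure u θb with hγ
  set mb : ℝ := ∫ w, ‖w‖ ∂γ with hmb
  have hmb0 : 0 ≤ mb := integral_nonneg fun _ => norm_nonneg _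
  have hmbE : ∫⁻ w, ENNReal.ofReal ‖w‖ ∂γ = ENNReal.ofReal mb := lintegral_norm_gaussMeasure_eq u θb
  refine ⟨32 * (1 + mb), by positivity, 1, fun N hN s s' hss' => ?_⟩
  have hclock : 0 ≤ clock σ N := by rw [clock]; positivity
  have hgeom := sq_mul_hsDiameter_sq σ N
  -- the common core: a level set `B`, an event `S` whose incoming pair meets `B`
  have core : ∀ {B : Set V3}, MeasurableSet B → ∀ S : Set VelEvent,
      (∀ q ∈ S, q.1.1 ∈ B ∨ q.1.2 ∈ B) →
      eventCount σ (fun _ => a) (fun _ => θb) (fun _ => u) N (Φ N) s s' S ≤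
        ENNReal.ofReal (16 * (s' - s) * ((N + 1 : ℕ) : ℝ) ^ 2 * hsDiameter σ N ^ 2) *
          (2 * (∫⁻ v, B.indicator (fun v => ENNReal.ofReal ‖v‖) v ∂γ +
            γ B * ENNReal.ofReal mb)) := by
    intro B hB S hS
    rcases eq_or_lt_of_le hss' with heq | hlt
    · -- empty window: no collision times in `(s, s]`
      have h0 : eventSum (Φ N) s s' S = fun _ => 0 := by
        funext z
        simp only [eventSum, ← heq, Set.Ioc_self, HardSphereFlow.collisionSum_eq,
          collisionSum_eq_collisionPairSum, collisionPairSum_empty]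
      rw [eventCount, h0, lintegral_zero]
      exact bot_le
    · set A : V3 × V3 → ℝ≥0∞ := fun p =>
        B.indicator (fun _ => (1 : ℝ≥0∞)) p.1 + B.indicator (fun _ => (1 : ℝ≥0∞)) p.2 with hA
      have hAm : Measurable A :=
        ((measurable_const.indicator hB).comp measurable_fst).add
          ((measurable_const.indicator hB).comp measurable_snd)
      have hA1 : ∀ q ∈ S, 1 ≤ A q.1 := by
        intro q hq
        rcases hS q hq with h | h
        · rw [hA]; dsimp only; rw [indicator_of_mem h]; exact le_self_add
        · rw [hA]; dsimp only; rw [indicator_of_mem h]; exact le_add_self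
      have hflux := localGibbsLaw_lintegral_le_of_le_collisionPreMarkSum hsm ha hθ u hN (Φ N)
        (sub_pos.2 hlt) hAm s (f := eventSum (Φ N) s s' S)
        (fun z hz => collisionSum_ite_indicator_le_collisionPreMarkSum (Φ N) hz s s' S hA1)
      refine hflux.trans ?_
      rw [← hmbE]
      exact mul_le_mul_right (lintegral_flux_levelMark_le γ hB) _
  -- packaging of the constants
  have pack : ∀ (X : ℝ≥0∞) {c : ℝ}, 0 ≤ c →
      ENNReal.ofReal (16 * (s' - s) * ((N + 1 : ℕ) : ℝ) ^ 2 * hsDiameter σ N ^ 2) *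
          (2 * (ENNReal.ofReal c * X + X * ENNReal.ofReal mb)) =
        ENNReal.ofReal (32 * (s' - s) * ((N : ℝ) + 1) * clock σ N * (c + mb)) * X := by
    intro X c hc
    rw [mul_comm X, ← add_mul, ← ENNReal.ofReal_add hc hmb0, ← mul_assoc (2 : ℝ≥0∞),
      ← ENNReal.ofReal_ofNat 2, ← ENNReal.ofReal_mul (by norm_num), ← mul_assoc,
      ← ENNReal.ofReal_mul (mul_nonneg (mul_nonneg (mul_nonneg (by norm_num) (sub_nonneg.2 hss'))
        (sq_nonneg _)) (sq_nonneg _))]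
    congr 2
    calc 16 * (s' - s) * ((N + 1 : ℕ) : ℝ) ^ 2 * hsDiameter σ N ^ 2 * (2 * (c + mb))
        = 32 * (s' - s) * (((N + 1 : ℕ) : ℝ) ^ 2 * hsDiameter σ N ^ 2) * (c + mb) := by ring
      _ = _ := by rw [hgeom]; ring
  have hN1 : ENNReal.ofReal ((N : ℝ) + 1) = ((N + 1 : ℕ) : ℝ≥0∞) := by
    rw [← ENNReal.ofReal_natCast, Nat.cast_succ]
  have hC : (0 : ℝ) ≤ 32 * (1 + mb) := by positivity
  constructor
  · -- shells
    intro E₁ E₂ hE₂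
    set B : Set V3 := {v : V3 | E₁ < ‖v‖ ^ 2 ∧ ‖v‖ ^ 2 ≤ E₂} with hBdef
    have hB : MeasurableSet B :=
      (measurableSet_lt measurable_const (continuous_norm.measurable.pow_const 2)).inter
        (measurableSet_le (continuous_norm.measurable.pow_const 2) measurable_const)
    have hsqrt1 : 1 ≤ Real.sqrt E₂ := by
      rw [← Real.sqrt_one]; exact Real.sqrt_le_sqrt hE₂
    -- `∫_B ‖v‖ ≤ √E₂ N(B)`
    have hJ : ∫⁻ v, B.indicator (fun v => ENNReal.ofReal ‖v‖) v ∂γ ≤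
        ENNReal.ofReal (Real.sqrt E₂) * γ B := by
      rw [← lintegral_indicator_const hB]
      refine lintegral_mono fun v => ?_
      by_cases hv : v ∈ B
      · rw [indicator_of_mem hv, indicator_of_mem hv]
        refine ENNReal.ofReal_le_ofReal ?_
        rw [← Real.sqrt_sq (norm_nonneg v)]
        exact Real.sqrt_le_sqrt hv.2
      · rw [indicator_of_notMem hv, indicator_of_notMem hv]
    -- the census at time `s`
    have hcensus : shellCensus σ (fun _ => a) (fun _ => θb) (fun _ => u) N (Φ N) s E₁ E₂ =
        ((N + 1 : ℕ) : ℝ≥0∞) * γ B := by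
      rw [shellCensus, ← hBdef, lintegral_sum_vel_localGibbsLaw_const hσ2 ha hθ u N (Φ N) s
        (measurable_const.indicator hB), lintegral_indicator_const hB, one_mul]
    have hsup : shellCensus σ (fun _ => a) (fun _ => θb) (fun _ => u) N (Φ N) s E₁ E₂ ≤
        ⨆ r ∈ Set.Icc s s', shellCensus σ (fun _ => a) (fun _ => θb) (fun _ => u) N (Φ N) r E₁ E₂ :=
      le_iSup₂ (f := fun r (_ : r ∈ Set.Icc s s') =>
        shellCensus σ (fun _ => a) (fun _ => θb) (fun _ => u) N (Φ N) r E₁ E₂) s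
        (Set.left_mem_Icc.2 hss')
    calc eventCount σ (fun _ => a) (fun _ => θb) (fun _ => u) N (Φ N) s s' (shellEvent E₁ E₂)
        ≤ ENNReal.ofReal (16 * (s' - s) * ((N + 1 : ℕ) : ℝ) ^ 2 * hsDiameter σ N ^ 2) *
            (2 * (∫⁻ v, B.indicator (fun v => ENNReal.ofReal ‖v‖) v ∂γ +
              γ B * ENNReal.ofReal mb)) := core hB _ fun q hq => hq
      _ ≤ ENNReal.ofReal (16 * (s' - s) * ((N + 1 : ℕ) : ℝ) ^ 2 * hsDiameter σ N ^ 2) *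
            (2 * (ENNReal.ofReal (Real.sqrt E₂) * γ B + γ B * ENNReal.ofReal mb)) := by
          gcongr
      _ = ENNReal.ofReal (32 * (s' - s) * ((N : ℝ) + 1) * clock σ N * (Real.sqrt E₂ + mb)) *
            γ B := pack (γ B) (Real.sqrt_nonneg _)
      _ ≤ ENNReal.ofReal (32 * (1 + mb) * clock σ N * Real.sqrt E₂ * (s' - s) * ((N : ℝ) + 1)) *
            γ B := by
          gcongr ENNReal.ofReal ?_ * _
          have h1 : Real.sqrt E₂ + mb ≤ (1 + mb) * Real.sqrt E₂ := by nlinarith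
          calc 32 * (s' - s) * ((N : ℝ) + 1) * clock σ N * (Real.sqrt E₂ + mb)
              = (32 * (s' - s) * ((N : ℝ) + 1) * clock σ N) * (Real.sqrt E₂ + mb) := by ring
            _ ≤ (32 * (s' - s) * ((N : ℝ) + 1) * clock σ N) * ((1 + mb) * Real.sqrt E₂) :=
                mul_le_mul_of_nonneg_left h1
                  (mul_nonneg (mul_nonneg (by linarith) (by positivity)) hclock)
            _ = _ := by ring
      _ = ENNReal.ofReal (32 * (1 + mb) * clock σ N * Real.sqrt E₂ * (s' - s)) *
            shellCensus σ (fun _ => a) (fun _ => θb) (fun _ => u) N (Φ N) s E₁ E₂ := by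
          rw [hcensus, ← mul_assoc, ← hN1, ← ENNReal.ofReal_mul (mul_nonneg
            (mul_nonneg (mul_nonneg hC hclock) (Real.sqrt_nonneg _)) (sub_nonneg.2 hss'))]
      _ ≤ _ := mul_le_mul_right hsup _
  · -- tails
    intro Y hY
    set B : Set V3 := {v : V3 | Y < ‖v‖ ^ 2} with hBdef
    have hB : MeasurableSet B :=
      measurableSet_lt measurable_const (continuous_norm.measurable.pow_const 2)
    -- `N(B) ≤ ∫_B ‖v‖` above `Y ≥ 1`
    have hJ : γ B ≤ ∫⁻ v, B.indicator (fun v => ENNReal.ofReal ‖v‖) v ∂γ := by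
      rw [← lintegral_indicator_one hB]
      refine lintegral_mono fun v => ?_
      by_cases hv : v ∈ B
      · rw [indicator_of_mem hv, indicator_of_mem hv, Pi.one_apply, ← ENNReal.ofReal_one]
        refine ENNReal.ofReal_le_ofReal ?_
        have hv' : (1 : ℝ) < ‖v‖ ^ 2 := lt_of_le_of_lt hY hv
        nlinarith [norm_nonneg v]
      · rw [indicator_of_notMem hv, indicator_of_notMem hv]
    set J : ℝ≥0∞ := ∫⁻ v, B.indicator (fun v => ENNReal.ofReal ‖v‖) v ∂γ with hJdef
    have hcensus : speedCensus σ (fun _ => a) (fun _ => θb) (fun _ => u) N (Φ N) s Y =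
        ((N + 1 : ℕ) : ℝ≥0∞) * J := by
      rw [speedCensus, ← hBdef, lintegral_sum_vel_localGibbsLaw_const hσ2 ha hθ u N (Φ N) s
        ((by fun_prop : Measurable fun v : V3 => ENNReal.ofReal ‖v‖).indicator hB)]
    have hsup : speedCensus σ (fun _ => a) (fun _ => θb) (fun _ => u) N (Φ N) s Y ≤
        ⨆ r ∈ Set.Icc s s', speedCensus σ (fun _ => a) (fun _ => θb) (fun _ => u) N (Φ N) r Y :=
      le_iSup₂ (f := fun r (_ : r ∈ Set.Icc s s') =>
        speedCensus σ (fun _ => a) (fun _ => θb) (fun _ => u) N (Φ N) r Y) s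
        (Set.left_mem_Icc.2 hss')
    have htail : ∀ q ∈ tailEvent Y, q.1.1 ∈ B ∨ q.1.2 ∈ B := by
      intro q hq
      have hq' : Y < max (‖q.1.1‖ ^ 2) (‖q.1.2‖ ^ 2) := hq
      rcases lt_max_iff.1 hq' with h | h
      · exact Or.inl h
      · exact Or.inr h
    calc eventCount σ (fun _ => a) (fun _ => θb) (fun _ => u) N (Φ N) s s' (tailEvent Y)
        ≤ ENNReal.ofReal (16 * (s' - s) * ((N + 1 : ℕ) : ℝ) ^ 2 * hsDiameter σ N ^ 2) *
            (2 * (J + γ B * ENNReal.ofReal mb)) := core hB _ htail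
      _ ≤ ENNReal.ofReal (16 * (s' - s) * ((N + 1 : ℕ) : ℝ) ^ 2 * hsDiameter σ N ^ 2) *
            (2 * (ENNReal.ofReal 1 * J + J * ENNReal.ofReal mb)) := by
          rw [ENNReal.ofReal_one, one_mul]
          gcongr
      _ = ENNReal.ofReal (32 * (s' - s) * ((N : ℝ) + 1) * clock σ N * (1 + mb)) * J :=
          pack J zero_le_one
      _ = ENNReal.ofReal (32 * (1 + mb) * clock σ N * (s' - s)) *
            speedCensus σ (fun _ => a) (fun _ => θb) (fun _ => u) N (Φ N) s Y := by
          rw [hcensus, ← mul_assoc, ← hN1, ← ENNReal.ofReal_mul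
            (mul_nonneg (mul_nonneg hC hclock) (sub_nonneg.2 hss'))]
          congr 2
          ring
      _ ≤ _ := mul_le_mul_right hsup _

end Summit.AtomisticToContinuum.HydrodynamicLimit.Theorems.EnergyCurrentTailsLevelCensus

end
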